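import Literature.Analysis.FluidPDE.OnsagerBDSVMikado
import HarnessLib

/-!
# Mikado flows on a neighbourhood of the identity (BDSV Lemma 5.1): identities, discharge of `BDSV.mikado_exists`

Buckmaster–De Lellis–Székelyhidi–Vicol, CPAM 72 (2019) = arXiv:1701.08678, Lemma 5.1 (= Daneri–Székelyhidi,
ARMA 224 (2017), Lemma 2.3) with the potential (5.9): the named fact `BDSV.mikado_exists` of
`OnsagerBDSVPerturbation.lean` (F₁ of the decomposition of the perturbation stage). With the fields
`W = BDSV.mikadoW`, `V = BDSV.mikadoV` of `OnsagerBDSVMikado.lean` (disjoint straight pipes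
`∑_x Γ̃_x(R) ψ_x k_x` and `∑_x Γ̃_x(R) k_x × ∇φ_x`), this file proves the identities of the printed proof
(DaSz17, proof of Lemma 2.3: "Thus `W` consists of a finite collection of disjoint straight tubes such that
in each tube `W` is a straight pipe flow … In particular `W` satisfies the stationary pressureless Euler
equations … `⨍ W ⊗ W = ∑_k Γ_k² k ⊗ k = R`"):

* `div W = ∑_x Γ̃_x (k_x·∇)ψ_x = 0`; `(W·∇)W = 0` (invariance of `ψ_x` along `k_x`, disjoint pipes);
  `∫ W = 0`; `∫ Wᵢ Wⱼ = ∑_x Γ̃_x² (k_x)ᵢ(k_x)ⱼ = Rᵢⱼ` (disjoint pipes, `∫ψ² = 1`, geometric lemma);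
* `curl V = W` from `curl (k × ∇φ) = k Δφ - (k·∇)∇φ = ψ k`; `div V = 0` (symmetry of second
  derivatives); `∫ V = 0` (integrals of derivatives vanish);
* `BDSV.mikadoDatum : MikadoDatum mikadoRadius` and **`BDSV.mikado_exists_holds : mikado_exists`**.

The other six facts of `OnsagerBDSVPerturbation.lean` (F₂ `cutoffs_exist`, …, F₇ `energyEstimate`) are
not treated here (F₃ `backwardFlow_exists_holds` is `OnsagerBDSVPerturbationProofs.lean`, F₂ and F₅ are
`OnsagerBDSVSquigglingCutoffs.lean`, `OnsagerBDSVPerturbationER.lean`; the module docstring of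
`OnsagerBDSVMikado.lean` announces the present file under the name `OnsagerBDSVPerturbationProofs`, which
was taken by F₃ in the meantime). Everything is proved; no named facts.

## Mathlib / tree search

Used from Mathlib: `integral_finsetSum`, `integral_smul_const`, `integral_const_mul`,
`ContinuousLinearMap.integral_comp_comm` (components of a vector integral), `PiLp.ext`, `Finset.sum_mul_sum`,
`linear_combination`. From the tree: `BDSV.curl`, `BDSV.MikadoDatum`, `BDSV.mikado_exists`
(`OnsagerBDSVPerturbation`), `Torus.partialDeriv_comm`, `partialDeriv_apply_coord`,
`laplacian_eq_sum_partialDeriv_partialDeriv`, `Continuous.integrable_unitAddTorus`, and everything of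
`OnsagerBDSVMikado`. `lean search mikado_exists_holds`: absent before this file.

## References

* T. Buckmaster, C. De Lellis, L. Székelyhidi Jr., V. Vicol, CPAM 72 (2019) 229–274 = arXiv:1701.08678,
  §5.1, Lemma 5.1 and (5.7)–(5.9). [`BuckmasterEtAl2018`]
* S. Daneri, L. Székelyhidi Jr., ARMA 224 (2017) = arXiv:1603.09714, Lemma 2.3 and its proof.
  [`DaneriSzekelyhidi2017`]
-/

open MeasureTheory Set
open scoped ContDiff Matrix.Norms.Elementwise

noncomputable section

namespace Literature.Analysis.FluidPDE

namespace BDSV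

open FunctionSpaces FunctionSpaces.Torus NashGeometric

/-- The flat three-torus `T³ = (ℝ/ℤ)³`, local notation. -/
local notation "𝕋³" => UnitAddTorus (Fin 3)

/-- Euclidean `ℝ³`, local notation. -/
local notation "ℝ³" => EuclideanSpace ℝ (Fin 3)

/-- Real `3 × 3` matrices, local notation. -/
local notation "𝕄" => Matrix (Fin 3) (Fin 3) ℝ

/-! ## The identities -/

section Identities

variable (R : 𝕄)

/-- `W(R, ·)` is smooth on `T³`. [folklore] -/
theorem isSmooth_mikadoW : IsSmooth (mikadoW R) := by
  show ContDiff ℝ ∞ fun v : ℝ³ => ∑ x, (mikadoCoeff x R * pipePsi x (proj v)) • Mikado.dirVec x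
  exact ContDiff.sum fun x _ => (ContDiff.mul contDiff_const (isSmooth_pipePsi x)).smul contDiff_const

/-- **`div W = 0`**: `div W = ∑_x Γ̃_x (k_x·∇)ψ_x = 0`. [cite: BuckmasterEtAl2018, Lemma 5.1 (5.7)] -/
theorem isDivFree_mikadoW : IsDivFree (mikadoW R) := by
  intro ξ
  unfold Torus.divergence
  have h : ∀ i : Fin 3, (fun y => mikadoW R y i) =
      fun y => ∑ x, (mikadoCoeff x R * Mikado.dirVec x i) * pipePsi x y := by
    intro i; funext y; rw [mikadoW_apply]; exact Finset.sum_congr rfl fun x _ => by ring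
  simp_rw [h, partialDeriv_sum_const_mul _ isSmooth_pipePsi]
  rw [Finset.sum_comm]
  refine Finset.sum_eq_zero fun x _ => ?_
  have h0 := sum_dirVec_mul_partialDeriv_pipePsi x ξ
  calc ∑ i, mikadoCoeff x R * Mikado.dirVec x i * partialDeriv i (pipePsi x) ξ
      = mikadoCoeff x R * ∑ i, Mikado.dirVec x i * partialDeriv i (pipePsi x) ξ := by
        rw [Finset.mul_sum]; exact Finset.sum_congr rfl fun i _ => by ring
    _ = 0 := by rw [h0, mul_zero]

/-- The partial derivatives of `W(R, ·)`: `∂ⱼ W = ∑_x (Γ̃_x ∂ⱼψ_x) k_x`. [folklore] -/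
theorem partialDeriv_mikadoW (j : Fin 3) (ξ : 𝕋³) :
    partialDeriv j (mikadoW R) ξ = ∑ x, (mikadoCoeff x R * partialDeriv j (pipePsi x) ξ) • Mikado.dirVec x := by
  unfold mikadoW
  have hterm : ∀ x : Index (Fin 3), IsContDiff 1 fun y => (mikadoCoeff x R * pipePsi x y) • Mikado.dirVec x :=
    fun x => (ContDiff.mul contDiff_const ((isSmooth_pipePsi x).isContDiff (by simp))).smul contDiff_const
  rw [partialDeriv_finset_sum _ (fun x _ => hterm x)]
  refine Finset.sum_congr rfl fun x _ => ?_
  have h1 : IsContDiff 1 fun y => mikadoCoeff x R * pipePsi x y :=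
    ContDiff.mul contDiff_const ((isSmooth_pipePsi x).isContDiff (by simp))
  rw [partialDeriv_smul h1 (isContDiff_const _), Torus.partialDeriv_const_apply, smul_zero, zero_add,
    Torus.partialDeriv_const_mul_apply ((isSmooth_pipePsi x).isContDiff (by simp))]

/-- **`(W·∇)W = 0`** (hence `div(W ⊗ W) = 0`): straight pipe flows in disjoint tubes.
[cite: BuckmasterEtAl2018, Lemma 5.1 (5.7)] -/
theorem convect_mikadoW (ξ : 𝕋³) : convect (mikadoW R) (mikadoW R) ξ = 0 := by
  unfold Torus.convect
  rw [fderiv_apply_eq_sum_partialDeriv ((isSmooth_mikadoW R).isContDiff (by simp))]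
  simp_rw [partialDeriv_mikadoW, Finset.smul_sum, smul_smul]
  rw [Finset.sum_comm]
  refine Finset.sum_eq_zero fun x _ => ?_
  rw [← Finset.sum_smul]
  suffices h : ∑ i, mikadoW R ξ i * (mikadoCoeff x R * partialDeriv i (pipePsi x) ξ) = 0 by
    rw [h, zero_smul]
  simp_rw [mikadoW_apply, Finset.sum_mul]
  rw [Finset.sum_comm]
  refine Finset.sum_eq_zero fun x' _ => ?_
  have h0 := pipePsi_mul_sum_dirVec_mul_partialDeriv x x' ξ
  calc ∑ i, mikadoCoeff x' R * pipePsi x' ξ * Mikado.dirVec x' i * (mikadoCoeff x R * partialDeriv i (pipePsi x) ξ)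
      = mikadoCoeff x' R * mikadoCoeff x R *
          (pipePsi x' ξ * ∑ i, Mikado.dirVec x' i * partialDeriv i (pipePsi x) ξ) := by
        rw [Finset.mul_sum, Finset.mul_sum]
        exact Finset.sum_congr rfl fun i _ => by ring
    _ = 0 := by rw [h0, mul_zero]

/-- **`∫ W = 0`**. [cite: BuckmasterEtAl2018, Lemma 5.1 (5.8)] -/
theorem integral_mikadoW : ∫ ξ, mikadoW R ξ = 0 := by
  unfold mikadoW
  rw [integral_finsetSum _ fun x _ => ?_]
  · refine Finset.sum_eq_zero fun x _ => ?_
    rw [integral_smul_const, integral_const_mul, integral_pipePsi, mul_zero, zero_smul]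
  · exact ((continuous_const.mul (isSmooth_pipePsi x).continuous).smul continuous_const).integrable_unitAddTorus

/-- Pointwise, the cross terms of `W ⊗ W` vanish: `Wᵢ Wⱼ = ∑_x Γ̃_x² ψ_x² (k_x)ᵢ (k_x)ⱼ`. [folklore] -/
theorem mikadoW_mul_mikadoW (ξ : 𝕋³) (i j : Fin 3) : mikadoW R ξ i * mikadoW R ξ j =
    ∑ x, mikadoCoeff x R ^ 2 * (Mikado.dirVec x i * Mikado.dirVec x j) * pipePsi x ξ ^ 2 := by
  rw [mikadoW_apply, mikadoW_apply, Finset.sum_mul_sum]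
  refine Finset.sum_congr rfl fun x _ => ?_
  rw [Finset.sum_eq_single x]
  · ring
  · intro x' _ hx'
    have h0 := pipePsi_mul_pipePsi (Ne.symm hx') ξ
    calc mikadoCoeff x R * pipePsi x ξ * Mikado.dirVec x i * (mikadoCoeff x' R * pipePsi x' ξ * Mikado.dirVec x' j)
        = mikadoCoeff x R * mikadoCoeff x' R * Mikado.dirVec x i * Mikado.dirVec x' j *
            (pipePsi x ξ * pipePsi x' ξ) := by ring
      _ = 0 := by rw [h0, mul_zero]
  · intro h; exact absurd (Finset.mem_univ x) h

/-- **`∫ Wᵢ Wⱼ = Rᵢⱼ`** for symmetric `R` with `‖R - Id‖_∞ ≤ 1/10` (disjoint pipes, `∫ ψ_x² = 1`, and the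
geometric lemma). [cite: BuckmasterEtAl2018, Lemma 5.1 (5.8)] -/
theorem integral_mikadoW_mul_mikadoW {R : 𝕄} (hR : R ∈ Metric.closedBall (1 : 𝕄) mikadoRadius)
    (hsym : R.IsSymm) (i j : Fin 3) : ∫ ξ, mikadoW R ξ i * mikadoW R ξ j = R i j := by
  simp_rw [mikadoW_mul_mikadoW]
  rw [integral_finsetSum _ fun x _ => ?_]
  · simp_rw [integral_const_mul, integral_pipePsi_sq, mul_one]
    rw [← sum_mikadoCoeff_sq hR hsym i j]
    rfl
  · exact (continuous_const.mul ((isSmooth_pipePsi x).continuous.pow 2)).integrable_unitAddTorus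

/-- `V(R, ·)` is smooth on `T³`, componentwise. [folklore] -/
theorem contDiff_mikadoV_comp : ContDiff ℝ ∞ fun p : 𝕄 × ℝ³ => mikadoV p.1 (proj p.2) := by
  rw [contDiff_euclidean]
  have hD : ∀ (x : Index (Fin 3)) (l : Fin 3), ContDiff ℝ ∞ fun p : 𝕄 × ℝ³ => partialDeriv l (pipePhi x) (proj p.2) :=
    fun x l => ((isSmooth_pipePhi x).partialDeriv l).comp contDiff_snd
  have hC : ∀ x : Index (Fin 3), ContDiff ℝ ∞ fun p : 𝕄 × ℝ³ => mikadoCoeff x p.1 :=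
    fun x => (contDiff_mikadoCoeff x).comp contDiff_fst
  intro i
  fin_cases i
  · simp only [Fin.zero_eta, mikadoV_apply_zero]
    exact ContDiff.sum fun x _ => (hC x).mul ((contDiff_const.mul (hD x 2)).sub (contDiff_const.mul (hD x 1)))
  · simp only [Fin.mk_one, mikadoV_apply_one]
    exact ContDiff.sum fun x _ => (hC x).mul ((contDiff_const.mul (hD x 0)).sub (contDiff_const.mul (hD x 2)))
  · simp only [Fin.reduceFinMk, mikadoV_apply_two]
    exact ContDiff.sum fun x _ => (hC x).mul ((contDiff_const.mul (hD x 1)).sub (contDiff_const.mul (hD x 0)))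

/-- `V(R, ·)` is smooth on `T³`. [folklore] -/
theorem isSmooth_mikadoV : IsSmooth (mikadoV R) := by
  unfold IsSmooth
  rw [show lift (mikadoV R) = (fun p : 𝕄 × ℝ³ => mikadoV p.1 (proj p.2)) ∘ fun y : ℝ³ => (R, y) from rfl]
  exact contDiff_mikadoV_comp.comp (contDiff_prodMk_right R)

/-- Second derivatives of the potentials, abbreviated: `H x j a = ∂ⱼ∂ₐ φ_x`. [folklore] -/
def hess (x : Index (Fin 3)) (j a : Fin 3) (ξ : 𝕋³) : ℝ := partialDeriv j (partialDeriv a (pipePhi x)) ξ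

/-- `∂ⱼ V₀ = ∑ Γ̃ (k₁ ∂ⱼ∂₂φ - k₂ ∂ⱼ∂₁φ)`. [folklore] -/
theorem partialDeriv_mikadoV_zero (j : Fin 3) (ξ : 𝕋³) : partialDeriv j (fun y => mikadoV R y 0) ξ =
    ∑ x, mikadoCoeff x R * (Mikado.dirVec x 1 * hess x j 2 ξ - Mikado.dirVec x 2 * hess x j 1 ξ) := by
  simp_rw [mikadoV_apply_zero]
  rw [partialDeriv_sum_const_mul _ (fun x => isSmooth_mul_sub_mul ((isSmooth_pipePhi x).partialDeriv 2)
    ((isSmooth_pipePhi x).partialDeriv 1) _ _)]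
  refine Finset.sum_congr rfl fun x _ => ?_
  rw [partialDeriv_mul_sub_mul ((isSmooth_pipePhi x).partialDeriv 2) ((isSmooth_pipePhi x).partialDeriv 1)]
  rfl

/-- `∂ⱼ V₁ = ∑ Γ̃ (k₂ ∂ⱼ∂₀φ - k₀ ∂ⱼ∂₂φ)`. [folklore] -/
theorem partialDeriv_mikadoV_one (j : Fin 3) (ξ : 𝕋³) : partialDeriv j (fun y => mikadoV R y 1) ξ =
    ∑ x, mikadoCoeff x R * (Mikado.dirVec x 2 * hess x j 0 ξ - Mikado.dirVec x 0 * hess x j 2 ξ) := by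
  simp_rw [mikadoV_apply_one]
  rw [partialDeriv_sum_const_mul _ (fun x => isSmooth_mul_sub_mul ((isSmooth_pipePhi x).partialDeriv 0)
    ((isSmooth_pipePhi x).partialDeriv 2) _ _)]
  refine Finset.sum_congr rfl fun x _ => ?_
  rw [partialDeriv_mul_sub_mul ((isSmooth_pipePhi x).partialDeriv 0) ((isSmooth_pipePhi x).partialDeriv 2)]
  rfl

/-- `∂ⱼ V₂ = ∑ Γ̃ (k₀ ∂ⱼ∂₁φ - k₁ ∂ⱼ∂₀φ)`. [folklore] -/
theorem partialDeriv_mikadoV_two (j : Fin 3) (ξ : 𝕋³) : partialDeriv j (fun y => mikadoV R y 2) ξ =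
    ∑ x, mikadoCoeff x R * (Mikado.dirVec x 0 * hess x j 1 ξ - Mikado.dirVec x 1 * hess x j 0 ξ) := by
  simp_rw [mikadoV_apply_two]
  rw [partialDeriv_sum_const_mul _ (fun x => isSmooth_mul_sub_mul ((isSmooth_pipePhi x).partialDeriv 1)
    ((isSmooth_pipePhi x).partialDeriv 0) _ _)]
  refine Finset.sum_congr rfl fun x _ => ?_
  rw [partialDeriv_mul_sub_mul ((isSmooth_pipePhi x).partialDeriv 1) ((isSmooth_pipePhi x).partialDeriv 0)]
  rfl

/-- `Δφ_x = ∑ₗ ∂ₗ∂ₗ φ_x = ψ_x` in terms of `hess`. [folklore] -/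
theorem hess_trace (x : Index (Fin 3)) (ξ : 𝕋³) : hess x 0 0 ξ + hess x 1 1 ξ + hess x 2 2 ξ = pipePsi x ξ := by
  have h := laplacian_eq_sum_partialDeriv_partialDeriv (isSmooth_pipePhi x) ξ
  rw [laplacian_pipePhi, Fin.sum_univ_three] at h
  exact h.symm

/-- `∑ₗ (k_x)ₗ ∂ₗ∂_c φ_x = 0` in terms of `hess`. [folklore] -/
theorem hess_dir (x : Index (Fin 3)) (c : Fin 3) (ξ : 𝕋³) :
    Mikado.dirVec x 0 * hess x 0 c ξ + Mikado.dirVec x 1 * hess x 1 c ξ + Mikado.dirVec x 2 * hess x 2 c ξ = 0 := by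
  have h := sum_dirVec_mul_partialDeriv_partialDeriv_pipePhi x c ξ
  rwa [Fin.sum_univ_three] at h

/-- Mixed second derivatives of `φ_x` commute. [folklore] -/
theorem hess_comm (x : Index (Fin 3)) (j a : Fin 3) (ξ : 𝕋³) : hess x j a ξ = hess x a j ξ :=
  partialDeriv_comm (isSmooth_pipePhi x) j a ξ

/-- The matrix of partial derivatives of `V`: `∂ⱼ V(ξ)ᵢ = ∂ⱼ (V · i)(ξ)`. [folklore] -/
theorem partialDeriv_mikadoV_apply (j : Fin 3) (ξ : 𝕋³) (i : Fin 3) :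
    partialDeriv j (mikadoV R) ξ i = partialDeriv j (fun y => mikadoV R y i) ξ :=
  (partialDeriv_apply_coord ((isSmooth_mikadoV R).isContDiff (by simp)) j ξ i).symm

/-- **`curl V = W`**: `curl (k × ∇φ) = k Δφ - (k·∇)∇φ = ψ k` for each pipe.
[cite: BuckmasterEtAl2018, §5.1 (5.9)] -/
theorem curl_mikadoV (ξ : 𝕋³) : curl (mikadoV R) ξ = mikadoW R ξ := by
  refine PiLp.ext fun i => ?_
  simp only [curl, partialDeriv_mikadoV_apply, partialDeriv_mikadoV_zero, partialDeriv_mikadoV_one,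
    partialDeriv_mikadoV_two, mikadoW_apply]
  fin_cases i
  · simp only [Fin.zero_eta, Matrix.cons_val_zero]
    rw [← Finset.sum_sub_distrib]
    refine Finset.sum_congr rfl fun x _ => ?_
    have h1 := hess_trace x ξ
    have h2 := hess_dir x 0 ξ
    linear_combination mikadoCoeff x R * Mikado.dirVec x 0 * h1 - mikadoCoeff x R * h2
  · simp only [Fin.mk_one, Matrix.cons_val_one, Matrix.cons_val_zero]
    rw [← Finset.sum_sub_distrib]
    refine Finset.sum_congr rfl fun x _ => ?_
    have h1 := hess_trace x ξ
    have h2 := hess_dir x 1 ξ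
    linear_combination mikadoCoeff x R * Mikado.dirVec x 1 * h1 - mikadoCoeff x R * h2
  · simp only [Fin.reduceFinMk, Matrix.cons_val]
    rw [← Finset.sum_sub_distrib]
    refine Finset.sum_congr rfl fun x _ => ?_
    have h1 := hess_trace x ξ
    have h2 := hess_dir x 2 ξ
    linear_combination mikadoCoeff x R * Mikado.dirVec x 2 * h1 - mikadoCoeff x R * h2

/-- **`div V = 0`**: `div (k × ∇φ) = 0` by the symmetry of second derivatives.
[cite: BuckmasterEtAl2018, §5.1 (5.9)] -/
theorem isDivFree_mikadoV : IsDivFree (mikadoV R) := by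
  intro ξ
  unfold Torus.divergence
  rw [Fin.sum_univ_three, partialDeriv_mikadoV_zero, partialDeriv_mikadoV_one, partialDeriv_mikadoV_two,
    ← Finset.sum_add_distrib, ← Finset.sum_add_distrib]
  refine Finset.sum_eq_zero fun x _ => ?_
  rw [hess_comm x 0 2, hess_comm x 1 0, hess_comm x 2 1]
  ring

/-- **`∫ V = 0`** (integrals of derivatives of periodic functions vanish).
[cite: BuckmasterEtAl2018, §5.1 (5.9)] -/
theorem integral_mikadoV : ∫ ξ, mikadoV R ξ = 0 := by
  have hint : Integrable (mikadoV R) := (isSmooth_mikadoV R).integrable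
  refine PiLp.ext fun i => ?_
  have h := (EuclideanSpace.proj i : ℝ³ →L[ℝ] ℝ).integral_comp_comm hint
  simp only [EuclideanSpace.proj, PiLp.proj_apply] at h
  change (∫ ξ, mikadoV R ξ).ofLp i = (0 : ℝ³).ofLp i
  rw [← h]
  have hI : ∀ (x : Index (Fin 3)) (l : Fin 3), Integrable fun ξ => partialDeriv l (pipePhi x) ξ :=
    fun x l => ((isSmooth_pipePhi x).partialDeriv l).integrable
  have hc : ∀ (x : Index (Fin 3)) (l : Fin 3), Continuous (partialDeriv l (pipePhi x)) :=
    fun x l => ((isSmooth_pipePhi x).partialDeriv l).continuous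
  have hcont : ∀ (x : Index (Fin 3)) (a b : Fin 3), Continuous fun ξ => mikadoCoeff x R *
      (Mikado.dirVec x a * partialDeriv b (pipePhi x) ξ - Mikado.dirVec x b * partialDeriv a (pipePhi x) ξ) :=
    fun x a b => continuous_const.mul ((continuous_const.mul (hc x b)).sub (continuous_const.mul (hc x a)))
  fin_cases i
  · simp only [Fin.zero_eta, mikadoV_apply_zero, PiLp.zero_apply]
    rw [integral_finsetSum _ fun x _ => (hcont x 1 2).integrable_unitAddTorus]
    refine Finset.sum_eq_zero fun x _ => ?_
    rw [integral_const_mul, integral_sub ((hI x 2).const_mul _) ((hI x 1).const_mul _), integral_const_mul,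
      integral_const_mul, integral_partialDeriv_pipePhi, integral_partialDeriv_pipePhi]
    ring
  · simp only [Fin.mk_one, mikadoV_apply_one, PiLp.zero_apply]
    rw [integral_finsetSum _ fun x _ => (hcont x 2 0).integrable_unitAddTorus]
    refine Finset.sum_eq_zero fun x _ => ?_
    rw [integral_const_mul, integral_sub ((hI x 0).const_mul _) ((hI x 2).const_mul _), integral_const_mul,
      integral_const_mul, integral_partialDeriv_pipePhi, integral_partialDeriv_pipePhi]
    ring
  · simp only [Fin.reduceFinMk, mikadoV_apply_two, PiLp.zero_apply]
    rw [integral_finsetSum _ fun x _ => (hcont x 0 1).integrable_unitAddTorus]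
    refine Finset.sum_eq_zero fun x _ => ?_
    rw [integral_const_mul, integral_sub ((hI x 1).const_mul _) ((hI x 0).const_mul _), integral_const_mul,
      integral_const_mul, integral_partialDeriv_pipePhi, integral_partialDeriv_pipePhi]
    ring

end Identities

/-! ## The datum and the discharge of `BDSV.mikado_exists` -/

section Datum

/-- **Mikado flows on `𝒩 = {R = Rᵀ : ‖R - Id‖_∞ ≤ 1/10}` as a `BDSV.MikadoDatum`**: `W = mikadoW`,
`V = mikadoV`. [cite: BuckmasterEtAl2018, Lemma 5.1 and (5.9)] -/
def mikadoDatum : MikadoDatum mikadoRadius where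
  W := mikadoW
  V := mikadoV
  smooth_W := by
    unfold mikadoW
    exact ContDiff.sum fun x _ =>
      (((contDiff_mikadoCoeff x).comp contDiff_fst).mul ((isSmooth_pipePsi x).comp contDiff_snd)).smul
        contDiff_const
  smooth_V := contDiff_mikadoV_comp
  divFree_W R _ _ := isDivFree_mikadoW R
  convect_W R _ _ ξ := convect_mikadoW R ξ
  integral_W R _ _ := integral_mikadoW R
  integral_WW R hR hsym i j := integral_mikadoW_mul_mikadoW hR hsym i j
  curl_V R _ _ ξ := curl_mikadoV R ξ
  divFree_V R _ _ := isDivFree_mikadoV R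
  integral_V R _ _ := integral_mikadoV R

/-- **Discharge of `BDSV.mikado_exists`** (BDSV Lemma 5.1 = DaSz17 Lemma 2.3, with the potential (5.9)):
Mikado flows exist on the neighbourhood `‖R - Id‖_∞ ≤ 1/10` of the identity.
[cite: BuckmasterEtAl2018, Lemma 5.1] -/
theorem mikado_exists_holds : mikado_exists :=
  ⟨mikadoDatum⟩

end Datum

end BDSV

end Literature.Analysis.FluidPDE
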